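import Mathlib
import Summits.Ventures.PercRepro.TriangleCapStarFamilyNecessity

/-!
# PercRepro — THE NECESSITY OF THE THRESHOLD `m ≥ D + r − 2` FOR `D < 2 r ≤ 2 D − 4` (p3, gen 56; part 322)

The mirror of part 321 for the upper residues: with `ρ = D − r ≥ 2` and `D + 1 ≤ 2 r`, off `I = ρ` the function
`I ↦ 2 I + φ_D(t + I) + φ_D(t − I)` exceeds its minimum `2 ρ (D − 2 ρ + 1)` by at least `2` (`residue_strict_upper`),
and for `m ≤ D + r − 3` every graph of the band has `t (t − 1) + 2 ρ (D − 2 ρ + 1) + 2 ≤ 2 j + 2 t (D − 1)`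
(`else_bottom_strict_upper`): equality would force `I = ρ`, every column empty or full, at most one partial row
(so at most `m + 1` active rows: `D · #full ≤ Σ_rows c = (m + 1) D − 2 ρ`), and an inside edge `x x'` with
`c(x) = c(x') = D` gives `2 D ≤ (m + 1) + (ρ + 1)`, i.e. `m ≥ D + r − 2`.  With part 319 the residue minimum is
attained in this regime EXACTLY for `m ≥ D + r − 2`.  Axioms: standard.
-/

namespace PercRepro

namespace TriangleCap

namespace C047

open Finset

variable {V : Type*} [Fintype V] [DecidableEq V]

/-- **THE STRICT RESIDUE BOUND FOR `D < 2 r`, `ρ = D − r ≥ 2`:** off `I = ρ`,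
`2 ρ (D − 2 ρ + 1) + 2 ≤ 2 I + φ_D(t + I) + φ_D(t − I)`. -/
theorem residue_strict_upper (D t I : ℕ) (hD : 0 < D) (hI : I ≤ t) (h1 : D + 1 ≤ 2 * (t % D))
    (h2 : t % D + 2 ≤ D) (hIρ : I ≠ D - t % D) :
    2 * ((D - t % D) * (D - 2 * (D - t % D) + 1)) + 2 ≤ 2 * I + phiD D (t + I) + phiD D (t - I) := by
  obtain ⟨r, hr⟩ : ∃ r, t % D = r := ⟨_, rfl⟩
  rw [hr] at h1 h2 hIρ ⊢
  have hrD : r < D := by omega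
  obtain ⟨ρ, rfl⟩ : ∃ ρ, D = r + ρ := ⟨D - r, by omega⟩
  have e0 : r + ρ - r = ρ := by omega
  rw [e0] at hIρ ⊢
  have hρ2 : 2 ≤ ρ := by omega
  have hphi2r : phiD (r + ρ) (2 * r) = 2 * ρ * (r + ρ - 2 * ρ) := by
    unfold phiD
    rw [Nat.mod_eq_sub_mod (by omega : r + ρ ≤ 2 * r), Nat.mod_eq_of_lt (by omega : 2 * r - (r + ρ) < r + ρ)]
    have e1 : 2 * r - (r + ρ) = r + ρ - 2 * ρ := by omega
    have e2 : r + ρ - (r + ρ - 2 * ρ) = 2 * ρ := by omega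
    rw [e1, e2]
    ring
  have htarget : 2 * (ρ * (r + ρ - 2 * ρ + 1)) = 2 * ρ + phiD (r + ρ) (2 * r) := by
    rw [hphi2r]
    ring
  rcases Nat.eq_zero_or_pos I with rfl | hI1
  · -- `I = 0`: `2 φ(r) = 2 r ρ = target + 2 ρ (ρ − 1)`
    simp only [add_zero, Nat.sub_zero, mul_zero, zero_add]
    rw [phiD_mod (r + ρ) t, hr, phiD_of_lt (r + ρ) r hrD, htarget, hphi2r, e0]
    obtain ⟨c, rfl⟩ : ∃ c, r = ρ + c := ⟨r - ρ, by omega⟩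
    have e3 : ρ + c + ρ - 2 * ρ = c := by omega
    rw [e3]
    nlinarith
  · rcases Nat.lt_or_ge I ρ with hIρ' | hIρ''
    · -- `1 ≤ I < ρ`
      have hA : phiD (r + ρ) (t + I) = (r + I) * (r + ρ - r - I) := by
        rw [phiD_mod, Nat.add_mod, hr, Nat.mod_eq_of_lt (show I < r + ρ by omega),
          Nat.mod_eq_of_lt (show r + I < r + ρ by omega), phiD_of_lt (r + ρ) _ (by omega), Nat.sub_sub]
      have hB : phiD (r + ρ) (t - I) = (r - I) * (r + ρ - r + I) := by
        have ht : t - I = (r + ρ) * (t / (r + ρ)) + (r - I) := by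
          have := Nat.div_add_mod t (r + ρ)
          omega
        rw [phiD_mod, ht, Nat.mul_add_mod, Nat.mod_eq_of_lt (by omega : r - I < r + ρ),
          phiD_of_lt (r + ρ) _ (by omega)]
        congr 1
        omega
      rw [hA, hB, htarget, hphi2r]
      have e4 : r + ρ - r - I = ρ - I := by omega
      have e5 : r + ρ - r + I = ρ + I := by omega
      have e6 : r + ρ - 2 * ρ = r - ρ := by omega
      rw [e4, e5, e6]
      have hpr : 1 * 1 ≤ (ρ - I) * (ρ + I - 1) := Nat.mul_le_mul (by omega) (by omega)
      zify [hIρ'.le, (by omega : ρ ≤ r), (by omega : 1 ≤ ρ + I), (by omega : I ≤ r)] at hpr ⊢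
      nlinarith [hpr]
    · -- `I > ρ`: subadditivity
      have hsub : phiD (r + ρ) (2 * t) ≤ phiD (r + ρ) (t + I) + phiD (r + ρ) (t - I) := by
        have := phiD_add_le (r + ρ) (t + I) (t - I)
        have e : t + I + (t - I) = 2 * t := by omega
        rw [e] at this
        exact this
      rw [phiD_two_mul_mod, hr] at hsub
      rw [htarget]
      omega

/-- **THE RESIDUE MINIMUM IS NOT ATTAINED BELOW THE THRESHOLD, UPPER RESIDUES:** for `D + 1 ≤ 2 r`, `r + 2 ≤ D`,
`ρ = D − r`, `t = m D + r`, `m ≤ D + r − 3`, every triangle-free `H` with `s` edges, `w` of degree `s − t ≥ 1`, every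
off-degree `≤ D`, at the band value `2 j` has `t (t − 1) + 2 ρ (D − 2 ρ + 1) + 2 ≤ 2 j + 2 t (D − 1)`. -/
theorem else_bottom_strict_upper (H : SimpleGraph V) [DecidableRel H.Adj] (hfree : H.CliqueFree 3) (s m r D j : ℕ)
    (h1 : D + 1 ≤ 2 * r) (h2 : r + 2 ≤ D) (hm : m + 3 ≤ D + r) (hs : H.edgeFinset.card = s) (w : V)
    (hw : deg H w + (m * D + r) = s) (hw1 : 1 ≤ deg H w)
    (hj : ∑ v, deg H v * deg H v + 2 * ((m * D + r) * (s - (m * D + r) - 1)) + 2 * j = s * (s + 1))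
    (hD : ∀ v, offDeg H w v ≤ D) :
    (m * D + r) * (m * D + r - 1) + 2 * ((D - r) * (D - 2 * (D - r) + 1)) + 2 ≤
      2 * j + 2 * ((m * D + r) * (D - 1)) := by
  set t := m * D + r with ht
  have hD0 : 0 < D := by omega
  have hmod : t % D = r := by
    rw [ht, Nat.add_comm, Nat.add_mul_mod_self_right, Nat.mod_eq_of_lt (by omega)]
  obtain ⟨ρ, hρ⟩ : ∃ ρ, ρ = D - r := ⟨_, rfl⟩
  rw [← hρ]
  have hρ2 : 2 ≤ ρ := by omega
  have h2ρ : 2 * ρ + 1 ≤ D := by omega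
  have hdef := deficiency_identity_split H hfree s t j D hs w hw hw1 hj hD
  have hoff : (offEdges H w).card = t := by
    have := card_offEdges_add_deg H w
    omega
  have hatt := attach_add_card_inside H hfree w
  rw [hoff] at hatt
  have hsumcol := sum_offDeg_nonNbrs_eq_add_card_inside H hfree w
  rw [hoff] at hsumcol
  have hsumrow : ∑ y ∈ univ.filter (fun y => H.Adj w y), offDeg H w y = t - (insideEdges H w).card := by
    unfold attach at hatt
    omega
  have hIt : (insideEdges H w).card ≤ t := by omega
  have hcol := sum_mul_sub_ge_phi (nonNbrs H w) (offDeg H w) D (fun x _ => hD x)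
  have hrow := sum_mul_sub_ge_phi (univ.filter (fun y => H.Adj w y)) (offDeg H w) D (fun y _ => hD y)
  rw [hsumcol] at hcol
  rw [hsumrow] at hrow
  by_contra hcon
  rw [not_le] at hcon
  by_cases hIρ : (insideEdges H w).card = ρ
  swap
  · have := residue_strict_upper D t (insideEdges H w).card hD0 hIt (by rw [hmod]; exact h1)
      (by rw [hmod]; exact h2) (by rw [hmod, ← hρ]; exact hIρ)
    rw [hmod, ← hρ] at this
    omega
  rw [hIρ] at hdef hcol hrow hsumcol hsumrow
  -- `φ(t + ρ) = φ((m + 1) D) = 0`, `φ(t − ρ) = φ(2 r) = 2 ρ (D − 2 ρ)`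
  have hphi1 : phiD D (t + ρ) = 0 := by
    have e : t + ρ = D * (m + 1) := by
      rw [ht, hρ]
      have : D * (m + 1) = m * D + D := by ring
      rw [this]
      omega
    rw [e, phiD_mod, Nat.mul_mod_right]
    unfold phiD
    simp
  have etρ : t - ρ = D * m + (D - 2 * ρ) := by
    rw [ht, hρ, Nat.mul_comm D m]
    omega
  have hphi2 : phiD D (t - ρ) = 2 * ρ * (D - 2 * ρ) := by
    rw [etρ, phiD_mod, Nat.mul_add_mod, Nat.mod_eq_of_lt (by omega : D - 2 * ρ < D), phiD_of_lt D _ (by omega)]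
    have e2 : D - (D - 2 * ρ) = 2 * ρ := by omega
    rw [e2]
    ring
  rw [hphi1] at hcol
  rw [hphi2] at hrow
  have htarget : 2 * (ρ * (D - 2 * ρ + 1)) = 2 * ρ + 2 * ρ * (D - 2 * ρ) := by ring
  have hslack : ∑ x ∈ nonNbrs H w, offDeg H w x * (D - offDeg H w x) +
      ∑ y ∈ univ.filter (fun y => H.Adj w y), offDeg H w y * (D - offDeg H w y) ≤ 2 * ρ * (D - 2 * ρ) + 1 := by
    omega
  -- every column is empty or full
  have hcols : ∀ x ∈ nonNbrs H w, offDeg H w x = 0 ∨ offDeg H w x = D := by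
    intro x hx
    have hle := hD x
    have hterm : offDeg H w x * (D - offDeg H w x) ≤ 1 := by
      have := single_le_sum (f := fun x => offDeg H w x * (D - offDeg H w x)) (fun _ _ => Nat.zero_le _) hx
      omega
    by_contra hne
    rw [not_or] at hne
    obtain ⟨c', hc'⟩ : ∃ c', offDeg H w x = c' + 1 := ⟨offDeg H w x - 1, by omega⟩
    obtain ⟨d', hd'⟩ : ∃ d', D - offDeg H w x = d' + 1 := ⟨D - offDeg H w x - 1, by omega⟩
    rw [hd', hc'] at hterm
    have hDe : D = c' + d' + 2 := by omega
    have e : (c' + 1) * (d' + 1) = c' * d' + c' + d' + 1 := by ring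
    rw [e] at hterm
    omega
  -- at most one partial row
  have hone : ∀ y ∈ univ.filter (fun y => H.Adj w y), ∀ y' ∈ univ.filter (fun y => H.Adj w y), y ≠ y' →
      1 ≤ offDeg H w y → offDeg H w y < D → 1 ≤ offDeg H w y' → offDeg H w y' < D → False := by
    intro y hy y' hy' hne hy1 hy2 hy'1 hy'2
    have := sum_mul_sub_ge_phi_add_two (univ.filter (fun y => H.Adj w y)) (offDeg H w) D (fun z _ => hD z) y y'
      hy hy' hne hy1 hy2 hy'1 hy'2
    rw [hsumrow, hphi2] at this
    omega
  -- the active rows number at most `m + 1`: `D · #full ≤ Σ_rows c = (m + 1) D − 2 ρ`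
  have hfull : (univ.filter (fun y => H.Adj w y ∧ offDeg H w y = D)).card ≤ m := by
    have hsub : univ.filter (fun y => H.Adj w y ∧ offDeg H w y = D) ⊆ univ.filter (fun y => H.Adj w y) := by
      intro y hy
      rw [mem_filter] at hy ⊢
      exact ⟨hy.1, hy.2.1⟩
    have hle := sum_le_sum_of_subset (f := offDeg H w) hsub
    rw [sum_const_nat (m := D) (fun y hy => (mem_filter.mp hy).2.2), hsumrow] at hle
    -- `card * D ≤ t − ρ < (m + 1) D`
    have hlt : t - ρ < (m + 1) * D := by
      rw [etρ]
      have : (m + 1) * D = D * m + D := by ring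
      rw [this]
      omega
    have : (univ.filter (fun y => H.Adj w y ∧ offDeg H w y = D)).card * D < (m + 1) * D := by omega
    have := Nat.lt_of_mul_lt_mul_right this
    omega
  have hactive : (univ.filter (fun y => H.Adj w y ∧ 1 ≤ offDeg H w y)).card ≤ m + 1 := by
    have hsplit : univ.filter (fun y => H.Adj w y ∧ 1 ≤ offDeg H w y) ⊆
        univ.filter (fun y => H.Adj w y ∧ offDeg H w y = D) ∪
          univ.filter (fun y => H.Adj w y ∧ 1 ≤ offDeg H w y ∧ offDeg H w y < D) := by
      intro y hy
      rw [mem_filter] at hy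
      rw [mem_union, mem_filter, mem_filter]
      have := hD y
      by_cases h : offDeg H w y = D
      · exact Or.inl ⟨mem_univ _, hy.2.1, h⟩
      · exact Or.inr ⟨mem_univ _, hy.2.1, hy.2.2, by omega⟩
    have hpartial : (univ.filter (fun y => H.Adj w y ∧ 1 ≤ offDeg H w y ∧ offDeg H w y < D)).card ≤ 1 := by
      rw [card_le_one]
      intro y hy y' hy'
      rw [mem_filter] at hy hy'
      by_contra hne
      exact hone y (mem_filter.mpr ⟨mem_univ _, hy.2.1⟩) y' (mem_filter.mpr ⟨mem_univ _, hy'.2.1⟩) hne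
        hy.2.2.1 hy.2.2.2 hy'.2.2.1 hy'.2.2.2
    have := card_le_card hsplit
    have := card_union_le (univ.filter (fun y => H.Adj w y ∧ offDeg H w y = D))
      (univ.filter (fun y => H.Adj w y ∧ 1 ≤ offDeg H w y ∧ offDeg H w y < D))
    omega
  -- the inside edge `x x'`: both columns full
  obtain ⟨x, hx, x', hx', hxx'⟩ := exists_adj_nonNbrs H w (by omega)
  have hnb := nbrDeg_add_nbrDeg_le_active H hfree w x x' hx hx' hxx'
  have hin := inDeg_add_inDeg_le_inside_succ H w x x' hx hx' hxx'
  rw [hIρ] at hin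
  have hcx := offDeg_eq_nbrDeg_add_inDeg H w x hx
  have hcx' := offDeg_eq_nbrDeg_add_inDeg H w x' hx'
  have hin1 : 1 ≤ inDeg H w x := by
    unfold inDeg
    exact card_pos.mpr ⟨x', mem_filter.mpr ⟨hx', hxx'⟩⟩
  have hin1' : 1 ≤ inDeg H w x' := by
    unfold inDeg
    exact card_pos.mpr ⟨x, mem_filter.mpr ⟨hx, H.adj_symm hxx'⟩⟩
  have hxD := hcols x hx
  have hx'D := hcols x' hx'
  omega

end C047

end TriangleCap

end PercRepro
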